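import Summits.BirchSwinnertonDyer.BirchSwinnertonDyer.Theorems.BiquadraticEisensteinDescentHeegnerTwistCouplingInSupplySqrtTwoCell
import Summits.BirchSwinnertonDyer.BirchSwinnertonDyer.Theorems.BiquadraticEisensteinDescentHeegnerTwistCouplingInSupplySqrtTwoPin
import Literature.NumberTheory.EllipticCurves.ComplexMultiplicationHasCMProofs
import Literature.NumberTheory.EllipticCurves.ComplexMultiplicationMaximalOrderProofs
import Literature.NumberTheory.EllipticCurves.ComplexMultiplicationShaHeckeProofs
import Literature.NumberTheory.EllipticCurves.ComplexMultiplicationLFunctionTableProofs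
import Literature.NumberTheory.EllipticCurves.BSDSelmerCMPConverse
import Literature.NumberTheory.EllipticCurves.AnalyticRankOrderProofs
import Literature.NumberTheory.EllipticCurves.NonEisensteinPrimeOfSurjective
import Literature.NumberTheory.EllipticCurves.CongruentNumberCurveSupersingular
import Literature.NumberTheory.EllipticCurves.LFunctionPrimeCoeff
import Literature.NumberTheory.EllipticCurves.QuadraticTwist
import HarnessLib

set_option linter.dupNamespace false -- `Summit.BirchSwinnertonDyer.BirchSwinnertonDyer.Theorems.…` (summit = sub)
set_option autoImplicit false

/-!
# Crux `HeegnerTwistCouplingInSupply` (stmt-BirchSwinnertonDyer-21381) — card `sqrt2-isogeny-heegner-pin`, corner T_A CLOSED modulo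
# Burungale–Tian + Deuring–Hecke: for every prime `p ≡ 5 (mod 8)`, `p ≡ ±2 (mod 5)` and `W = B_p : y² = x³ + 4p x² + 2p² x`
# (`j = 8000`, CM by `ℤ[√−2]`, `p` inert and bad), the Heegner field `K′ = ℚ(√−5ℓ)` of the pin has `L(W^{(d_{K′})}, 1) ≠ 0`,
# `h(K′) < p`, `p ∤ h(K′)`

Route `BiquadraticEisensteinDescent` (cell `pub/bsd-wall`, width seat `bsd-wall-cm-bed-w1` g10; `--supports` 21381, helper). Sequel of
`…SqrtTwoCell` (CELL-5: `corank_{ℤ₂} Sel_{2^∞}(B_{−m}/ℚ) = 0` for `m > 0` square-free with all prime factors `≡ ±3 (mod 8)`,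
UNCONDITIONAL) and of the lead's `…SqrtTwoPin` (p651152: the pin `ℓ ≡ 3 (mod 8)`, `(ℓ/p) = −1`, `ℓ < p` and the field half
`exists_sqrtTwoPin_witnessField`). Contents:

* §1 the family `B_n = ⟨0, 4n, 0, 2n², 0⟩ = B_1^{(n)}` (`quadraticTwist_B_one`, `quadraticTwist_B`): `j(B_n) = 8000` (`j_B`), hence
  `HasCM` (`hasCM_B`, tree theorem `hasCM_of_j_eq_8000`) and `j ∈ maximalCMJInvariants`;
* §2 ★ `L_one_ne_zero_B_neg` — **`r_an(B_{−m}) = 0` and `L(B_{−m}, 1) ≠ 0`** on CELL-5, modulo Burungale–Tian's rank-zero `2`-converse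
  for CM curves (`hBT`, applied at the prime `2` to `corank = 0` from `…SqrtTwoCell`) and the Deuring–Hecke continuation (`hH`, only to
  read `r_an = 0` as `L(1) ≠ 0`);
* §3 `B_p`: good reduction away from `2p` (the `ℤ`-model has `Δ = 2⁹p⁶`; `hasGoodReductionAt_map_of_not_dvd`), so every prime divisor
  of `N(B_p)` is `2` or `p` (`not_dvd_conductorNorm_of_hasGoodReductionAtPrime`) — no modularity, no conductor value;
* §4 ★★ `cruxOnBpCorner_of_two_facts` — **T_A**: for every prime `p ≡ 5 (mod 8)`, `p ≡ ±2 (mod 5)` there is a Heegner field `K′` of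
  `N(B_p)` (`= ℚ(√−5ℓ)`, `ℓ` the pin) with `4 < |d_{K′}|`, `L(B_p^{(d_{K′})}, 1) ≠ 0` (`B_p^{(−5ℓ)} = B_{−5pℓ}` lies in CELL-5),
  `h(K′) < p` and `p ∤ h(K′)` — the CONCLUSION of crux 21381 for `W = B_p`, modulo `hBT ∧ hH` only (the `E_p`/`E_{2p}` corners of
  this layer carry Monsky + Burungale–Tian + Burungale–Flach).

HONEST FRAMING: a typed sub-corner rung on one explicit CM family (half of the inert class `p ≡ 5 (mod 8)` of `j = 8000`); the hypotheses
`CMInert B_p p`, `¬ Good B_p p`, `r_an(B_p) = 1` of the crux are not needed for (and not proved with) the conclusion; the crux (all CM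
`W` of analytic rank one; residual C⁺ = positive density of `p ∤ h` in a Heegner family) is untouched; BSD is not proved by any of this.
THEOREMS ONLY (no `def`, no `sorry`, no new named fact); supports stmt-BirchSwinnertonDyer-21381.
-/

noncomputable section

open scoped Classical NumberField

namespace Summit.BirchSwinnertonDyer.BirchSwinnertonDyer.Theorems.BiquadraticEisensteinDescentHeegnerTwistCouplingInSupplySqrtTwoCorner

open _root_.WeierstrassCurve Literature.NumberTheory.EllipticCurves
open IsDedekindDomain Rat.HeightOneSpectrum
open Summit.BirchSwinnertonDyer.BirchSwinnertonDyer.Theorems.BiquadraticEisensteinDescentHeegnerTwistCouplingInSupplySqrtTwoCell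
open Summit.BirchSwinnertonDyer.BirchSwinnertonDyer.Theorems.BiquadraticEisensteinDescentHeegnerTwistCouplingInSupplySqrtTwoPin

/-! ## §1 The family `B_n : y² = x³ + 4n x² + 2n² x` (`j = 8000`) -/

section Family

/-- `B_n` is the quadratic twist by `n` of the conductor-`256` curve `B_1 : y² = x³ + 4x² + 2x`. [cite: SilvermanAdvancedTopics1994, App. A §3 (D = −8)] -/
theorem quadraticTwist_B_one (n : ℚ) :
    (⟨0, 4, 0, 2, 0⟩ : WeierstrassCurve ℚ).quadraticTwist n = ⟨0, 4 * n, 0, 2 * n ^ 2, 0⟩ := by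
  rw [quadraticTwist_mk]; ext <;> simp <;> ring

/-- Twisting inside the family: `B_n^{(d)} = B_{nd}` on the nose. [cite: SilvermanAEC2009, X.2 and X.5] -/
theorem quadraticTwist_B (n d : ℚ) :
    (⟨0, 4 * n, 0, 2 * n ^ 2, 0⟩ : WeierstrassCurve ℚ).quadraticTwist d = ⟨0, 4 * (n * d), 0, 2 * (n * d) ^ 2, 0⟩ := by
  rw [← quadraticTwist_B_one, quadraticTwist_quadraticTwist, quadraticTwist_B_one]

/-- `B_n` is an elliptic curve for `n ≠ 0` (`Δ = 2⁹ n⁶`). [folklore] -/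
theorem isElliptic_Bfam {n : ℚ} (hn : n ≠ 0) : (⟨0, 4 * n, 0, 2 * n ^ 2, 0⟩ : WeierstrassCurve ℚ).IsElliptic := by
  rw [isElliptic_mk_twoTorsion_iff]
  rw [show (16 : ℚ) * (2 * n ^ 2) ^ 2 * ((4 * n) ^ 2 - 4 * (2 * n ^ 2)) = 512 * n ^ 6 by ring]
  exact mul_ne_zero (by norm_num) (pow_ne_zero 6 hn)

/-- **`j(B_n) = 8000`** (`j = 256(a² − 3b)³/(b²(a² − 4b))` with `a² − 3b = 10n²`, `b²(a² − 4b) = 32n⁶`). [cite: SilvermanAEC2009, App. C §11, Example 11.3.1–11.3.2] -/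
theorem j_B {n : ℚ} (hn : n ≠ 0) [hE : (⟨0, 4 * n, 0, 2 * n ^ 2, 0⟩ : WeierstrassCurve ℚ).IsElliptic] :
    (⟨0, 4 * n, 0, 2 * n ^ 2, 0⟩ : WeierstrassCurve ℚ).j = 8000 := by
  rw [j_mk_twoTorsion]
  have h6 : n ^ 6 ≠ 0 := pow_ne_zero 6 hn
  rw [div_eq_iff (by rw [show (2 * n ^ 2) ^ 2 * ((4 * n) ^ 2 - 4 * (2 * n ^ 2)) = 32 * n ^ 6 by ring]; positivity)]
  ring

/-- **`B_n` has complex multiplication** (by `ℤ[√−2]`; tree theorem `hasCM_of_j_eq_8000`). [cite: SilvermanAEC2009, App. C §11, Example 11.3.1–11.3.2] -/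
theorem hasCM_B {n : ℚ} (hn : n ≠ 0) [hE : (⟨0, 4 * n, 0, 2 * n ^ 2, 0⟩ : WeierstrassCurve ℚ).IsElliptic] :
    (⟨0, 4 * n, 0, 2 * n ^ 2, 0⟩ : WeierstrassCurve ℚ).HasCM :=
  hasCM_of_j_eq_8000 _ (j_B hn)

/-- `j(B_n) = 8000` is one of the nine maximal-order CM `j`-invariants (the Deuring–Hecke leaf's hypothesis). [cite: SilvermanAEC2009, App. C §11, Example 11.3.1] -/
theorem j_B_mem_maximalCMJInvariants {n : ℚ} (hn : n ≠ 0) [hE : (⟨0, 4 * n, 0, 2 * n ^ 2, 0⟩ : WeierstrassCurve ℚ).IsElliptic] :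
    (⟨0, 4 * n, 0, 2 * n ^ 2, 0⟩ : WeierstrassCurve ℚ).j ∈ maximalCMJInvariants := by
  rw [j_B hn]
  simp [maximalCMJInvariants]

/-- The CELL-5 literal `⟨0, −4m, 0, 2m², 0⟩` of `…SqrtTwoCell` is `B_{−m}`. [folklore] -/
theorem B_neg_eq (m : ℤ) :
    (⟨0, -4 * (m : ℚ), 0, 2 * (m : ℚ) ^ 2, 0⟩ : WeierstrassCurve ℚ) = ⟨0, 4 * (-(m : ℚ)), 0, 2 * (-(m : ℚ)) ^ 2, 0⟩ := by
  ext <;> simp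

end Family

/-! ## §2 `L(B_{−m}, 1) ≠ 0` on CELL-5, modulo Burungale–Tian + Deuring–Hecke -/

section LValue

variable {m : ℤ}

/-- ★ **CELL-5, `L`-form: `r_an(B_{−m}) = 0` and `L(B_{−m}, 1) ≠ 0`** for `m > 0` square-free with every prime factor `≡ ±3 (mod 8)`,
modulo Burungale–Tian (`corank_{ℤ₂} Sel_{2^∞} = 0`, from `…SqrtTwoCell.selmerCorank_two_B_eq_zero`, and CM give `r_an = 0`; the
fact allows `p = 2`) and Deuring–Hecke (`L(B_{−m}, s)` entire, `j = 8000 ∈ maximalCMJInvariants`, to read `r_an = 0` as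
`L(1) ≠ 0` via `analyticRank_eq_zero_iff_holds`). The instance argument is `…SqrtTwoCell.isElliptic_B`.
[cite: BurungaleTian2026, Thm. 1.1] [cite: SilvermanAEC2009, App. C §11, Example 11.3.1] -/
theorem L_one_ne_zero_B_neg (hBT : burungaleTian_analyticRank_eq_zero_of_selmerCorank_eq_zero_of_hasCM)
    (hH : hasEntireLFunction_of_j_mem_maximalCMJInvariants) (hm0 : 0 < m) (hm : Squarefree m)
    (hm8 : ∀ r : ℕ, r.Prime → (r : ℤ) ∣ m → r % 8 = 3 ∨ r % 8 = 5)
    [hE : (⟨0, -4 * (m : ℚ), 0, 2 * (m : ℚ) ^ 2, 0⟩ : WeierstrassCurve ℚ).IsElliptic] :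
    (⟨0, -4 * (m : ℚ), 0, 2 * (m : ℚ) ^ 2, 0⟩ : WeierstrassCurve ℚ).analyticRank = 0 ∧
      (⟨0, -4 * (m : ℚ), 0, 2 * (m : ℚ) ^ 2, 0⟩ : WeierstrassCurve ℚ).entireLFunction 1 ≠ 0 := by
  haveI : Fact (Nat.Prime 2) := ⟨Nat.prime_two⟩
  have hn : (-(m : ℚ)) ≠ 0 := neg_ne_zero.mpr (by exact_mod_cast hm0.ne')
  haveI hE' : (⟨0, 4 * (-(m : ℚ)), 0, 2 * (-(m : ℚ)) ^ 2, 0⟩ : WeierstrassCurve ℚ).IsElliptic := isElliptic_Bfam hn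
  have hj : (⟨0, -4 * (m : ℚ), 0, 2 * (m : ℚ) ^ 2, 0⟩ : WeierstrassCurve ℚ).j = 8000 := by
    have h := j_B hn
    simp only [← B_neg_eq] at h
    convert h
  have hCM : (⟨0, -4 * (m : ℚ), 0, 2 * (m : ℚ) ^ 2, 0⟩ : WeierstrassCurve ℚ).HasCM := hasCM_of_j_eq_8000 _ hj
  have h0 := hBT _ hCM 2 (selmerCorank_two_B_eq_zero hm0 hm hm8)
  refine ⟨h0, (analyticRank_eq_zero_iff_holds (W := (⟨0, -4 * (m : ℚ), 0, 2 * (m : ℚ) ^ 2, 0⟩ : WeierstrassCurve ℚ))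
    (hH _ ?_)).1 h0⟩
  rw [hj]
  simp [maximalCMJInvariants]

end LValue

/-! ## §3 `B_p`: good reduction away from `2p`, the support of the conductor -/

section Conductor

/-- The `ℤ`-model `⟨0, 4p, 0, 2p², 0⟩` maps to `B_p`. [folklore] -/
theorem map_BInt (p : ℕ) :
    (⟨0, 4 * (p : ℤ), 0, 2 * (p : ℤ) ^ 2, 0⟩ : WeierstrassCurve ℤ).map (Int.castRingHom ℚ) = ⟨0, 4 * (p : ℚ), 0, 2 * (p : ℚ) ^ 2, 0⟩ := by
  ext <;> simp [WeierstrassCurve.map]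

/-- `Δ(⟨0, 4p, 0, 2p², 0⟩) = 2⁹ p⁶`. [cite: SilvermanAEC2009, III.1 (b₂, b₄, b₆, b₈, Δ)] -/
theorem BInt_Δ (p : ℕ) : (⟨0, 4 * (p : ℤ), 0, 2 * (p : ℤ) ^ 2, 0⟩ : WeierstrassCurve ℤ).Δ = 512 * (p : ℤ) ^ 6 := by
  simp only [WeierstrassCurve.Δ, WeierstrassCurve.b₂, WeierstrassCurve.b₄, WeierstrassCurve.b₆, WeierstrassCurve.b₈]
  ring

/-- A prime `r ∤ 2p` does not divide `Δ = 2⁹ p⁶`. [folklore] -/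
theorem not_dvd_BInt_Δ {p r : ℕ} (hr : r.Prime) (hrp : ¬ r ∣ 2 * p) :
    ¬ (r : ℤ) ∣ (⟨0, 4 * (p : ℤ), 0, 2 * (p : ℤ) ^ 2, 0⟩ : WeierstrassCurve ℤ).Δ := by
  rw [BInt_Δ]
  intro h
  have h' : r ∣ 512 * p ^ 6 := by exact_mod_cast h
  rcases (Nat.Prime.dvd_mul hr).mp h' with h512 | hp6
  · exact hrp ((hr.dvd_of_dvd_pow (show r ∣ 2 ^ 9 by simpa using h512)).mul_right p)
  · exact hrp ((hr.dvd_of_dvd_pow hp6).mul_left 2)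

/-- **`B_p` has good reduction at every prime `r ∤ 2p`** (`r ∤ Δ` of the `ℤ`-model; Silverman VII.5.1(a) in the tree's prime-indexed form).
[cite: SilvermanAEC2009, VII.5 Prop. 5.1(a)] -/
theorem hasGoodReductionAtPrime_B {p r : ℕ} [Fact r.Prime] (hrp : ¬ r ∣ 2 * p) :
    (⟨0, 4 * (p : ℚ), 0, 2 * (p : ℚ) ^ 2, 0⟩ : WeierstrassCurve ℚ).HasGoodReductionAtPrime r := by
  obtain ⟨v, rfl⟩ : ∃ v : HeightOneSpectrum (𝓞 ℚ), (primesEquiv v : ℕ) = r :=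
    ⟨primesEquiv.symm ⟨r, Fact.out⟩, by rw [Equiv.apply_symm_apply]⟩
  rw [← map_BInt]
  exact (hasGoodReductionAtPrime_iff_hasGoodReductionAt_ringOfIntegers v _).2
    (hasGoodReductionAt_map_of_not_dvd _ v (not_dvd_BInt_Δ Fact.out hrp))

/-- **Every prime divisor of `N(B_p)` is `2` or `p`** (no modularity: a prime of good reduction does not divide the conductor,
`not_dvd_conductorNorm_of_hasGoodReductionAtPrime`). [cite: SilvermanATAEC1994, Thm. IV.10.2(a)] -/
theorem eq_two_or_eq_of_prime_dvd_conductorNorm_B {p r : ℕ} [(⟨0, 4 * (p : ℚ), 0, 2 * (p : ℚ) ^ 2, 0⟩ : WeierstrassCurve ℚ).IsElliptic]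
    (hp : p.Prime) (hr : r.Prime) (h : r ∣ (⟨0, 4 * (p : ℚ), 0, 2 * (p : ℚ) ^ 2, 0⟩ : WeierstrassCurve ℚ).conductorNorm ℤ) :
    r = 2 ∨ r = p := by
  by_contra hne
  push Not at hne
  have hrp : ¬ r ∣ 2 * p := fun hd => by
    rcases (Nat.Prime.dvd_mul hr).mp hd with h2 | hp'
    · exact hne.1 ((Nat.prime_dvd_prime_iff_eq hr Nat.prime_two).mp h2)
    · exact hne.2 ((Nat.prime_dvd_prime_iff_eq hr hp).mp hp')
  haveI : Fact r.Prime := ⟨hr⟩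
  exact not_dvd_conductorNorm_of_hasGoodReductionAtPrime _ (hasGoodReductionAtPrime_B hrp) h

end Conductor

/-! ## §4 ★★ Corner T_A: `W = B_p`, `p ≡ 5 (mod 8)`, `p ≡ ±2 (mod 5)` -/

section Corner

/-- `B_p^{(−5ℓ)}` is the CELL-5 literal `B_{−m}` with `m = 5pℓ`. [cite: SilvermanAEC2009, X.2 and X.5] -/
theorem quadraticTwist_B_neg_five_mul (p ℓ : ℕ) :
    (⟨0, 4 * (p : ℚ), 0, 2 * (p : ℚ) ^ 2, 0⟩ : WeierstrassCurve ℚ).quadraticTwist ((-((5 * ℓ : ℕ) : ℤ) : ℤ) : ℚ) =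
      ⟨0, -4 * (((5 * p * ℓ : ℕ) : ℤ) : ℚ), 0, 2 * (((5 * p * ℓ : ℕ) : ℤ) : ℚ) ^ 2, 0⟩ := by
  rw [quadraticTwist_B]
  ext <;> push_cast <;> ring

/-- **`B_p` has complex multiplication** (the crux hypothesis `HasCM`, for the record). [cite: SilvermanAEC2009, App. C §11, Example 11.3.1] -/
theorem hasCM_Bp (p : ℕ) [Fact p.Prime] [(⟨0, 4 * (p : ℚ), 0, 2 * (p : ℚ) ^ 2, 0⟩ : WeierstrassCurve ℚ).IsElliptic] :
    (⟨0, 4 * (p : ℚ), 0, 2 * (p : ℚ) ^ 2, 0⟩ : WeierstrassCurve ℚ).HasCM :=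
  hasCM_B (by exact_mod_cast (Fact.out : p.Prime).ne_zero)

/-- ★★ **CORNER T_A of card `sqrt2-isogeny-heegner-pin`, TWO NAMED FACTS.** For every prime `p ≡ 5 (mod 8)` with `p ≡ ±2 (mod 5)`
and `W = B_p : y² = x³ + 4p x² + 2p² x` (`j = 8000`, CM by `ℤ[√−2]`, `p` inert in `ℚ(√−2)` and bad): there is an imaginary quadratic
field `K′` (`= ℚ(√−5ℓ)`, `ℓ ≡ 3 (mod 8)` the pin prime of `pinThreeMinus_of_mod_eight_eq_five`, `(ℓ/p) = −1`, `ℓ < p`) with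
`4 < |d_{K′}|`, Heegner for `N(B_p)` (every prime divisor of `N(B_p)` is `2` or `p`; `d_{K′} ≡ 1 (mod 8)`, `(d_{K′}/p) = +1`),
`L(B_p^{(d_{K′})}, 1) ≠ 0` (`B_p^{(−5ℓ)} = B_{−5pℓ}` and `m = 5pℓ` is in CELL-5: complete `2`-isogeny descent, UNCONDITIONAL, then
Burungale–Tian at the prime `2`), `h(K′) < p` (size: `5ℓ < 6p`) and hence `p ∤ h(K′)` — the CONCLUSION of crux 21381 for `W = B_p`,
modulo `hBT` (Burungale–Tian) and `hH` (Deuring–Hecke) only. The binders `IsGloballyMinimal`, `NeZero N` mirror the crux and are unused.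
[cite: BurungaleTian2026, Thm. 1.1] [cite: SilvermanAEC2009, Prop. X.4.9 and Thm. X.4.2(a)] [cite: Oesterle1988Gauss, II §3 Proposition p. 57 (27)] -/
theorem cruxOnBpCorner_of_two_facts (hBT : burungaleTian_analyticRank_eq_zero_of_selmerCorank_eq_zero_of_hasCM)
    (hH : hasEntireLFunction_of_j_mem_maximalCMJInvariants) :
    ∀ (p : ℕ) [Fact p.Prime] [(⟨0, 4 * (p : ℚ), 0, 2 * (p : ℚ) ^ 2, 0⟩ : WeierstrassCurve ℚ).IsElliptic]
      [(⟨0, 4 * (p : ℚ), 0, 2 * (p : ℚ) ^ 2, 0⟩ : WeierstrassCurve ℚ).IsGloballyMinimal]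
      [NeZero ((⟨0, 4 * (p : ℚ), 0, 2 * (p : ℚ) ^ 2, 0⟩ : WeierstrassCurve ℚ).conductorNorm ℤ)],
      p % 8 = 5 → (p % 5 = 2 ∨ p % 5 = 3) →
      ∃ (K : Type) (_ : Field K) (_ : NumberField K),
        IsImaginaryQuadratic K ∧ 4 < (NumberField.discr K).natAbs ∧
        SatisfiesHeegnerHypothesis ((⟨0, 4 * (p : ℚ), 0, 2 * (p : ℚ) ^ 2, 0⟩ : WeierstrassCurve ℚ).conductorNorm ℤ) K ∧
        ((⟨0, 4 * (p : ℚ), 0, 2 * (p : ℚ) ^ 2, 0⟩ : WeierstrassCurve ℚ).quadraticTwist (NumberField.discr K : ℚ)).entireLFunction 1 ≠ 0 ∧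
        NumberField.classNumber K < p ∧ ¬ p ∣ NumberField.classNumber K := by
  intro p hpF _ _ _ hp8 hp5
  have hp : p.Prime := hpF.out
  obtain ⟨ℓ, K, iF, iN, hℓ, hℓp, hℓ8, -, -, -, hK, hdK, hH', hcl, hsq, hfac⟩ :=
    exists_sqrtTwoPin_witnessField hp hp8 hp5 (N := (⟨0, 4 * (p : ℚ), 0, 2 * (p : ℚ) ^ 2, 0⟩ : WeierstrassCurve ℚ).conductorNorm ℤ)
      (fun r hr hrN => eq_two_or_eq_of_prime_dvd_conductorNorm_B hp hr hrN)
  refine ⟨K, iF, iN, hK, ?_, hH', ?_, hcl, fun hdvd =>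
    absurd (Nat.le_of_dvd (NumberField.classNumber_pos K) hdvd) (not_le.mpr hcl)⟩
  · rw [hdK, Int.natAbs_neg, Int.natAbs_natCast]
    have := hℓ.two_le
    omega
  · -- `B_p^{(−5ℓ)} = B_{−m}`, `m = 5pℓ` in CELL-5
    rw [hdK, quadraticTwist_B_neg_five_mul]
    have hm0 : (0 : ℤ) < ((5 * p * ℓ : ℕ) : ℤ) := by
      have := hp.pos
      have := hℓ.pos
      positivity
    have hmsq : Squarefree (((5 * p * ℓ : ℕ) : ℤ)) := Int.squarefree_natCast.mpr hsq
    have hm8 : ∀ r : ℕ, r.Prime → (r : ℤ) ∣ ((5 * p * ℓ : ℕ) : ℤ) → r % 8 = 3 ∨ r % 8 = 5 :=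
      fun r hr hrd => hfac r hr (by exact_mod_cast hrd)
    haveI := isElliptic_B hm0.ne'
    exact (L_one_ne_zero_B_neg hBT hH hm0 hmsq hm8).2

end Corner

/-! ## §5 (append, for the CELL-15 files of seat `bed-w2` g12) Generic `L`-form from the corank, any `m ≠ 0` -/

section Generic

/-- ★ **Generic `L`-form for the family, from the corank**: for ANY `m ≠ 0`, if `corank_{ℤ₂} Sel_{2^∞}(B_{−m}/ℚ) = 0` (e.g. CELL-5:
`…SqrtTwoCell.selmerCorank_two_B_eq_zero`; CELL-15: `…SqrtTwoCellFifteen.selmerCorank_two_eq_zero`) then `r_an(B_{−m}) = 0` and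
`L(B_{−m}, 1) ≠ 0`, modulo Burungale–Tian (rank-zero `2`-converse for CM curves, at the prime `2`; `j(B_{−m}) = 8000`, `HasCM` by
`hasCM_of_j_eq_8000`) and Deuring–Hecke (`8000 ∈ maximalCMJInvariants`, to read `r_an = 0` as `L(1) ≠ 0`). Requested on the cell bus
(bed-w2 g12, 18:01Z) so that the `p ≡ 15 (mod 16)` corners T_B / T_C import it by name.
[cite: BurungaleTian2026, Thm. 1.1] [cite: SilvermanAEC2009, App. C §11, Example 11.3.1] -/
theorem L_one_ne_zero_B_neg_of_selmerCorank (hBT : burungaleTian_analyticRank_eq_zero_of_selmerCorank_eq_zero_of_hasCM)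
    (hH : hasEntireLFunction_of_j_mem_maximalCMJInvariants) {m : ℤ} (hm : m ≠ 0)
    [hE : (⟨0, -4 * (m : ℚ), 0, 2 * (m : ℚ) ^ 2, 0⟩ : WeierstrassCurve ℚ).IsElliptic]
    (hcor : (⟨0, -4 * (m : ℚ), 0, 2 * (m : ℚ) ^ 2, 0⟩ : WeierstrassCurve ℚ).selmerCorank 2 = 0) :
    (⟨0, -4 * (m : ℚ), 0, 2 * (m : ℚ) ^ 2, 0⟩ : WeierstrassCurve ℚ).analyticRank = 0 ∧
      (⟨0, -4 * (m : ℚ), 0, 2 * (m : ℚ) ^ 2, 0⟩ : WeierstrassCurve ℚ).entireLFunction 1 ≠ 0 := by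
  haveI : Fact (Nat.Prime 2) := ⟨Nat.prime_two⟩
  have hn : (-(m : ℚ)) ≠ 0 := neg_ne_zero.mpr (by exact_mod_cast hm)
  haveI hE' : (⟨0, 4 * (-(m : ℚ)), 0, 2 * (-(m : ℚ)) ^ 2, 0⟩ : WeierstrassCurve ℚ).IsElliptic := isElliptic_Bfam hn
  have hj : (⟨0, -4 * (m : ℚ), 0, 2 * (m : ℚ) ^ 2, 0⟩ : WeierstrassCurve ℚ).j = 8000 := by
    have h := j_B hn
    simp only [← B_neg_eq] at h
    convert h
  have h0 := hBT _ (hasCM_of_j_eq_8000 _ hj) 2 hcor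
  refine ⟨h0, (analyticRank_eq_zero_iff_holds (W := (⟨0, -4 * (m : ℚ), 0, 2 * (m : ℚ) ^ 2, 0⟩ : WeierstrassCurve ℚ))
    (hH _ ?_)).1 h0⟩
  rw [hj]
  simp [maximalCMJInvariants]

/-- **`j(B_{−m}) = 8000` and `B_{−m}` has CM**, for the `−m` literal (any `m ≠ 0`). [cite: SilvermanAEC2009, App. C §11, Example 11.3.1] -/
theorem j_and_hasCM_B_neg {m : ℤ} (hm : m ≠ 0) [hE : (⟨0, -4 * (m : ℚ), 0, 2 * (m : ℚ) ^ 2, 0⟩ : WeierstrassCurve ℚ).IsElliptic] :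
    (⟨0, -4 * (m : ℚ), 0, 2 * (m : ℚ) ^ 2, 0⟩ : WeierstrassCurve ℚ).j = 8000 ∧
      (⟨0, -4 * (m : ℚ), 0, 2 * (m : ℚ) ^ 2, 0⟩ : WeierstrassCurve ℚ).HasCM := by
  have hn : (-(m : ℚ)) ≠ 0 := neg_ne_zero.mpr (by exact_mod_cast hm)
  haveI hE' : (⟨0, 4 * (-(m : ℚ)), 0, 2 * (-(m : ℚ)) ^ 2, 0⟩ : WeierstrassCurve ℚ).IsElliptic := isElliptic_Bfam hn
  have hj : (⟨0, -4 * (m : ℚ), 0, 2 * (m : ℚ) ^ 2, 0⟩ : WeierstrassCurve ℚ).j = 8000 := by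
    have h := j_B hn
    simp only [← B_neg_eq] at h
    convert h
  exact ⟨hj, hasCM_of_j_eq_8000 _ hj⟩

end Generic

end Summit.BirchSwinnertonDyer.BirchSwinnertonDyer.Theorems.BiquadraticEisensteinDescentHeegnerTwistCouplingInSupplySqrtTwoCorner

end
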